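import Summits.RiemannHypothesis.RiemannHypothesis.Theorems.HandoffTranslatedKernel
import Literature.NumberTheory.LFunctions.Weil1952CriterionProofs
import Literature.NumberTheory.LFunctions.WeilWindowSuzukiContinuityProofs
import Literature.Analysis.Complex.VerticalSinSummation
import HarnessLib

/-!
# HANDOFF — the TRANSFORM OF THE DODGER WITNESS at a zero: `|Ĝ_δ(ρ)|² ≤ 4(1 + sinh²(δ/2))·|φ̂(ρ)|²·|F̂(ρ)|²` (rh-explicit, track «HANDOFF», seat prove-2 gen9, ATTEMPT-16 Lemma C1)

HONEST FRAMING. Nothing here bears on the truth of RH; this is bookkeeping for the COST side of the dodger wall ceiling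
(HOME/handoff/prove-2/ATTEMPT-16.md §4, Lemma C1). The witness of THEOREM 16.2 is `G_δ = θ(· − δ) − θ(· + δ)` with
`θ = F₀ ⋆ φ` — `F₀` a cut-off cosine polynomial (bounded, compactly supported, NOT continuous) and `φ` a mollifier. Lemma C1
says: `Ĝ_δ(s) = 2 sinh((s − ½)δ)·θ̂(s)`, `θ̂ = F̂₀·φ̂` at EVERY `s` (not only on the critical line), and at a zero
`ρ = β + iγ` with `0 ≤ β ≤ 1`: `|Ĝ_δ(ρ)|² ≤ 4(1 + sinh²(δ/2))·|φ̂(ρ)|²·|F̂₀(ρ)|²`, `|φ̂(ρ)| ≤ e^{r|β − ½|}` for a non-negative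
mollifier of radius `r` and mass `1`. THIS FILE proves these in the kernel, for arbitrary data:

* `weilMellin_mul_cexp`, `weilConv_mul_cexp_apply` — exponential tilting commutes with `weilMellin` (shift of `s`) and `weilConv`;
* `integrable_mul_cexp_of_support` — an integrable function vanishing off `[-R, R]` has all exponential moments;
* `weilMellin_weilConv_of_expIntegrable` — **`(f ⋆ g)^(s) = f̂(s)·ĝ(s)` for ALL `s`** when `f, g` have all exponential
  moments (the tree's `Weil1952.weilMellin_weilConv_of_integrable` is the critical-line case; continuity is NOT assumed —
  this is the «Mellin multiplicativity for a non-continuous factor» listed as missing in ATTEMPT-16 §8);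
* `isWeilTest_weilConv_of_locallyIntegrable` — `F ⋆ φ` is a Weil test function for `F` locally integrable with compact
  support and `φ` a test function (so the mollified cut-off cosine polynomial IS an admissible `θ`);
* `weilMellin_translatePair` — `Ĝ_δ(s) = 2 sinh((s − ½)δ)·θ̂(s)`; `norm_sinh_sq_eq`, `norm_two_sinh_sq_le` —
  `‖sinh(x+iy)‖² = sinh²x + sin²y ≤ sinh²(δ/2) + 1` for `|x| ≤ δ/2`;
* `norm_weilMellin_le_exp_of_nonneg` — `|φ̂(s)| ≤ e^{r|Re s − ½|}` for `φ ≥ 0` of mass `1` vanishing off `[-r, r]`;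
* `normSq_weilMellin_translatePair_le` — the assembled Lemma C1 bound.
No `sorry`, standard axioms, no definitions.

References: this track (ATTEMPT-16 §4, Lemma C1); E. Bombieri, Rend. Mat. Acc. Lincei (9) 11 (2000), §2 (Mellin transform of
the convolution; tree `Weil1952.weilMellin_weilConv_of_integrable`).
-/

set_option linter.dupNamespace false

noncomputable section

open Real Complex MeasureTheory Set
open scoped ComplexConjugate

namespace Summit.RiemannHypothesis.RiemannHypothesis.Theorems.Handoff

open Literature.NumberTheory.LFunctions

/-! ## §1 Exponential tilting -/

/-- Tilting by `e^{ct}` shifts the Mellin variable: `(f·e^{c·})^(s) = f̂(s + c)` (no hypotheses). [folklore] -/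
theorem weilMellin_mul_cexp (f : ℝ → ℂ) (c s : ℂ) :
    weilMellin (fun t : ℝ => f t * cexp (c * t)) s = weilMellin f (s + c) := by
  unfold weilMellin
  congr 1 with t
  rw [mul_assoc, ← Complex.exp_add]
  congr 2
  ring

/-- Tilting commutes with convolution: `((f·e^{c·}) ⋆ (g·e^{c·}))(x) = (f ⋆ g)(x)·e^{cx}` (no hypotheses). [folklore] -/
theorem weilConv_mul_cexp_apply (f g : ℝ → ℂ) (c : ℂ) (x : ℝ) :
    weilConv (fun t : ℝ => f t * cexp (c * t)) (fun t : ℝ => g t * cexp (c * t)) x =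
      weilConv f g x * cexp (c * x) := by
  rw [weilConv_apply, weilConv_apply, ← integral_mul_const]
  congr 1 with u
  have e : cexp (c * (u : ℂ)) * cexp (c * ((x - u : ℝ) : ℂ)) = cexp (c * (x : ℂ)) := by
    rw [← Complex.exp_add]; congr 1; push_cast; ring
  calc f u * cexp (c * u) * (g (x - u) * cexp (c * ((x - u : ℝ) : ℂ)))
      = f u * g (x - u) * (cexp (c * u) * cexp (c * ((x - u : ℝ) : ℂ))) := by ring
    _ = f u * g (x - u) * cexp (c * x) := by rw [e]

/-- An integrable function vanishing off `[-R, R]` has all exponential moments: `f·e^{c·} ∈ L¹` for every `c`. [folklore] -/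
theorem integrable_mul_cexp_of_support {f : ℝ → ℂ} (hf : Integrable f) {R : ℝ}
    (hR : ∀ t : ℝ, R < |t| → f t = 0) (c : ℂ) :
    Integrable fun t : ℝ => f t * cexp (c * t) := by
  refine (hf.norm.const_mul (Real.exp (‖c‖ * |R|))).mono'
    (hf.aestronglyMeasurable.mul (by fun_prop : Continuous fun t : ℝ => cexp (c * t)).aestronglyMeasurable)
    (Filter.Eventually.of_forall fun t => ?_)
  rcases le_or_gt |t| R with ht | ht
  · rw [norm_mul, mul_comm]
    refine mul_le_mul_of_nonneg_right ?_ (norm_nonneg _)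
    rw [Complex.norm_exp]
    refine Real.exp_le_exp.2 ?_
    calc (c * (t : ℂ)).re ≤ ‖c * (t : ℂ)‖ := Complex.re_le_norm _
      _ = ‖c‖ * |t| := by rw [norm_mul, Complex.norm_real, Real.norm_eq_abs]
      _ ≤ ‖c‖ * |R| := mul_le_mul_of_nonneg_left (ht.trans (le_abs_self R)) (norm_nonneg _)
  · rw [hR t ht]; simp

/-! ## §2 Mellin multiplicativity at every `s`, without continuity -/

/-- **`(f ⋆ g)^(s) = f̂(s)·ĝ(s)` for all `s`**, for `f, g` with all exponential moments (e.g. integrable with bounded support;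
NO continuity). Proof: tilt by `σ = Re s − ½` and apply the critical-line case `Weil1952.weilMellin_weilConv_of_integrable` at
`s − σ`. [cite: Bombieri2000Weil, §2] -/
theorem weilMellin_weilConv_of_expIntegrable {f g : ℝ → ℂ}
    (hf : ∀ σ : ℝ, Integrable fun t : ℝ => f t * cexp ((σ : ℂ) * t))
    (hg : ∀ σ : ℝ, Integrable fun t : ℝ => g t * cexp ((σ : ℂ) * t)) (s : ℂ) :
    weilMellin (weilConv f g) s = weilMellin f s * weilMellin g s := by
  set σ : ℝ := s.re - 1 / 2 with hσ
  have hs : (s - (σ : ℂ)).re = 1 / 2 := by simp [hσ]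
  have key := Weil1952.weilMellin_weilConv_of_integrable (hf σ) (hg σ) hs
  rw [weilMellin_mul_cexp, weilMellin_mul_cexp, sub_add_cancel] at key
  rw [← key]
  have e : weilConv (fun t : ℝ => f t * cexp ((σ : ℂ) * t)) (fun t : ℝ => g t * cexp ((σ : ℂ) * t)) =
      fun x : ℝ => weilConv f g x * cexp ((σ : ℂ) * x) := by
    funext x; exact weilConv_mul_cexp_apply f g σ x
  rw [e, weilMellin_mul_cexp, sub_add_cancel]

/-- `F ⋆ φ` is a Weil test function when `F` is locally integrable with compact support and `φ` is a test function
(Mathlib: `HasCompactSupport.contDiff_convolution_right`, `HasCompactSupport.convolution`; continuity of `F` is NOT needed —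
the dodger's cut-off cosine polynomial qualifies). [folklore] -/
theorem isWeilTest_weilConv_of_locallyIntegrable {F φ : ℝ → ℂ} (hF : LocallyIntegrable F)
    (hFs : HasCompactSupport F) (hφ : IsWeilTest φ) : IsWeilTest (weilConv F φ) := by
  rw [weilConv_eq_convolution_real]
  exact ⟨hφ.2.contDiff_convolution_right (ContinuousLinearMap.mul ℝ ℂ) hF hφ.1,
    HasCompactSupport.convolution (L := ContinuousLinearMap.mul ℝ ℂ) hFs hφ.2⟩

/-! ## §3 The translate pair and the `sinh` factor -/

/-- **`Ĝ_δ(s) = 2 sinh((s − ½)δ)·θ̂(s)`** for `G_δ = θ(· − δ) − θ(· + δ)`, `θ` continuous with compact support.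
[this track, ATTEMPT-16 Lemma C1] -/
theorem weilMellin_translatePair {θ : ℝ → ℂ} (hθc : Continuous θ) (hθs : HasCompactSupport θ) (δ : ℝ) (s : ℂ) :
    weilMellin (fun x : ℝ => θ (x - δ) - θ (x + δ)) s = 2 * Complex.sinh ((s - 1 / 2) * δ) * weilMellin θ s := by
  have h1c : Continuous fun x : ℝ => θ (x - δ) := hθc.comp (continuous_id.sub continuous_const)
  have h2c : Continuous fun x : ℝ => θ (x + δ) := hθc.comp (continuous_id.add continuous_const)
  have h1s : HasCompactSupport fun x : ℝ => θ (x - δ) := hθs.comp_homeomorph (Homeomorph.subRight δ)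
  have h2s : HasCompactSupport fun x : ℝ => θ (x + δ) := hθs.comp_homeomorph (Homeomorph.addRight δ)
  have e : (fun x : ℝ => θ (x - δ) - θ (x + δ)) = (fun x : ℝ => θ (x - δ)) - fun x : ℝ => θ (x + δ) := rfl
  rw [e, weilMellin_sub h1c h1s h2c h2s, weilMellin_comp_sub]
  have e2 : (fun x : ℝ => θ (x + δ)) = fun x : ℝ => θ (x - (-δ)) := by funext x; rw [sub_neg_eq_add]
  rw [e2, weilMellin_comp_sub, Complex.two_sinh]
  push_cast
  ring_nf

/-- `‖sinh(x + iy)‖² = sinh² x + sin² y`. [folklore] -/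
theorem norm_sinh_sq_eq (z : ℂ) : ‖Complex.sinh z‖ ^ 2 = Real.sinh z.re ^ 2 + Real.sin z.im ^ 2 := by
  have h1 : Complex.sinh z = -I * Complex.sin (z * I) := by
    rw [Complex.sin_mul_I]; ring_nf; simp
  rw [h1, norm_mul, norm_neg, Complex.norm_I, one_mul, Literature.Analysis.Complex.norm_sin_sq_eq]
  simp only [Complex.mul_I_re, Complex.mul_I_im, Real.sin_neg, even_two, Even.neg_pow]
  ring

/-- **The `sinh` factor at a point of the closed strip**: for `δ ≥ 0` and `|Re w| ≤ δ/2` (e.g. `w = (ρ − ½)δ` with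
`0 ≤ Re ρ ≤ 1`): `‖2 sinh w‖² ≤ 4(sinh²(δ/2) + 1)`. [this track, ATTEMPT-16 Lemma C1] -/
theorem norm_two_sinh_sq_le {w : ℂ} {δ : ℝ} (hw : |w.re| ≤ δ / 2) :
    ‖2 * Complex.sinh w‖ ^ 2 ≤ 4 * (Real.sinh (δ / 2) ^ 2 + 1) := by
  rw [norm_mul, mul_pow, Complex.norm_two, norm_sinh_sq_eq]
  have h1 : Real.sinh w.re ^ 2 ≤ Real.sinh (δ / 2) ^ 2 := by
    rw [← sq_abs (Real.sinh w.re), Real.abs_sinh]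
    have hδ : 0 ≤ δ / 2 := (abs_nonneg _).trans hw
    have h2 : Real.sinh |w.re| ≤ Real.sinh (δ / 2) := Real.sinh_le_sinh.2 hw
    have h3 : 0 ≤ Real.sinh |w.re| := Real.sinh_nonneg_iff.2 (abs_nonneg _)
    exact pow_le_pow_left₀ h3 h2 2
  have h4 : Real.sin w.im ^ 2 ≤ 1 := Real.sin_sq_le_one _
  nlinarith

/-! ## §4 The mollifier factor -/

/-- **`|φ̂(s)| ≤ e^{r|Re s − ½|}`** for `φ ≥ 0` (pointwise real non-negative values) of total mass `∫‖φ‖ = 1` vanishing off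
`[-r, r]`. (The tree's `WeilContinuous.norm_weilMellin_moll_le` is the case `r = 1` for its mollifiers.) [folklore] -/
theorem norm_weilMellin_le_exp_of_support {φ : ℝ → ℂ} {r : ℝ}
    (hφ0 : ∀ t : ℝ, r < |t| → φ t = 0) (hφi : Integrable fun t => ‖φ t‖) (hmass : ∫ t, ‖φ t‖ = 1) (s : ℂ) :
    ‖weilMellin φ s‖ ≤ Real.exp (r * |s.re - 1 / 2|) := by
  unfold weilMellin
  calc ‖∫ t : ℝ, φ t * cexp ((s - 1 / 2) * t)‖ ≤ ∫ t : ℝ, ‖φ t * cexp ((s - 1 / 2) * t)‖ :=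
        norm_integral_le_integral_norm _
    _ ≤ ∫ t : ℝ, ‖φ t‖ * Real.exp (r * |s.re - 1 / 2|) := by
        refine integral_mono_of_nonneg (Filter.Eventually.of_forall fun _ => norm_nonneg _)
          (hφi.mul_const _) (Filter.Eventually.of_forall fun t => ?_)
        simp only [norm_mul, Complex.norm_exp]
        rcases le_or_gt |t| r with ht | ht
        · refine mul_le_mul_of_nonneg_left (Real.exp_le_exp.2 ?_) (norm_nonneg _)
          have hre : ((s - 1 / 2) * (t : ℂ)).re = (s.re - 1 / 2) * t := by simp [sub_re, mul_re]
          rw [hre]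
          calc (s.re - 1 / 2) * t ≤ |(s.re - 1 / 2) * t| := le_abs_self _
            _ = |s.re - 1 / 2| * |t| := abs_mul _ _
            _ ≤ |s.re - 1 / 2| * r := by gcongr
            _ = r * |s.re - 1 / 2| := mul_comm _ _
        · rw [hφ0 t ht]; simp
    _ = Real.exp (r * |s.re - 1 / 2|) := by rw [integral_mul_const, hmass, one_mul]

/-! ## §5 Lemma C1 assembled -/

/-- **ATTEMPT-16 Lemma C1 (kernel).** Let `F` be integrable and vanish off `[-R, R]` (no continuity), `φ` a Weil test function
vanishing off `[-r, r]`, `θ := F ⋆ φ`, `G_δ := θ(· − δ) − θ(· + δ)` with `δ ≥ 0`. Then at every `s` with `0 ≤ Re s ≤ 1`: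
`‖Ĝ_δ(s)‖² ≤ 4(sinh²(δ/2) + 1)·‖φ̂(s)‖²·‖F̂(s)‖²`. (With `norm_weilMellin_le_exp_of_support`: `‖φ̂(s)‖² ≤ e^{2r|Re s − ½|} ≤ e^{r}`.)
[this track, ATTEMPT-16 Lemma C1] -/
theorem normSq_weilMellin_translatePair_le {F φ : ℝ → ℂ} (hFi : Integrable F) {R : ℝ}
    (hFR : ∀ t : ℝ, R < |t| → F t = 0) (hφ : IsWeilTest φ) {r : ℝ} (hφr : ∀ t : ℝ, r < |t| → φ t = 0)
    {δ : ℝ} (hδ : 0 ≤ δ) {s : ℂ} (hs0 : 0 ≤ s.re) (hs1 : s.re ≤ 1) :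
    ‖weilMellin (fun x : ℝ => weilConv F φ (x - δ) - weilConv F φ (x + δ)) s‖ ^ 2 ≤
      4 * (Real.sinh (δ / 2) ^ 2 + 1) * ‖weilMellin φ s‖ ^ 2 * ‖weilMellin F s‖ ^ 2 := by
  have hFs : HasCompactSupport F :=
    HasCompactSupport.of_support_subset_isCompact (isCompact_Icc (a := -R) (b := R)) fun t ht => by
      have h : |t| ≤ R := le_of_not_gt fun h' => (Function.mem_support.1 ht) (hFR t h')
      exact mem_Icc.2 (abs_le.1 h)
  have hθ : IsWeilTest (weilConv F φ) :=
    isWeilTest_weilConv_of_locallyIntegrable hFi.locallyIntegrable hFs hφ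
  rw [weilMellin_translatePair hθ.1.continuous hθ.2 δ s]
  have hφi : Integrable φ := hφ.1.continuous.integrable_of_hasCompactSupport hφ.2
  rw [weilMellin_weilConv_of_expIntegrable (fun σ => integrable_mul_cexp_of_support hFi hFR σ)
    (fun σ => integrable_mul_cexp_of_support hφi hφr σ) s]
  set A : ℂ := 2 * Complex.sinh ((s - 1 / 2) * δ) with hA
  rw [norm_mul, norm_mul (weilMellin F s), mul_pow, mul_pow]
  have hw : |((s - 1 / 2) * (δ : ℂ)).re| ≤ δ / 2 := by
    have hre : ((s - 1 / 2) * (δ : ℂ)).re = (s.re - 1 / 2) * δ := by simp [sub_re, mul_re]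
    rw [hre, abs_mul, abs_of_nonneg hδ]
    have : |s.re - 1 / 2| ≤ 1 / 2 := abs_le.2 ⟨by linarith, by linarith⟩
    nlinarith
  have h1 := norm_two_sinh_sq_le hw
  have h2 : 0 ≤ ‖weilMellin F s‖ ^ 2 := sq_nonneg _
  have h3 : 0 ≤ ‖weilMellin φ s‖ ^ 2 := sq_nonneg _
  calc ‖A‖ ^ 2 * (‖weilMellin F s‖ ^ 2 * ‖weilMellin φ s‖ ^ 2)
      ≤ 4 * (Real.sinh (δ / 2) ^ 2 + 1) * (‖weilMellin F s‖ ^ 2 * ‖weilMellin φ s‖ ^ 2) :=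
        mul_le_mul_of_nonneg_right h1 (by positivity)
    _ = 4 * (Real.sinh (δ / 2) ^ 2 + 1) * ‖weilMellin φ s‖ ^ 2 * ‖weilMellin F s‖ ^ 2 := by ring

end Summit.RiemannHypothesis.RiemannHypothesis.Theorems.Handoff

end
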